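import Literature.Analysis.FluidPDE.NSCriticalClosureBesovBounded
import Literature.Analysis.FluidPDE.TaoLocalisationHolds
import HarnessLib

/-!
# Classical Leray–Hopf solutions lie in Kato's weighted classes `K̊^s_p`

Analysis/FluidPDE proof file (theorems only: no definition, no named fact, no statement of the
tree is changed), on the discharge path of the named fact
`Literature.Analysis.FluidPDE.hasSmoothExtensionPast_of_eHomBesovNorm_bounded`
(`NSCriticalClosure.lean`): companion of `NSClassicalPathSpace.lean` (classical solutions lie in
GKP's path space `𝓛^{1:∞}_{p,q}[T' < T]`).

Albritton's corrected solution class (`AlbrittonBlowupCriterionKato.lean`, after Albritton 2018,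
Thm. 4.2 (4.52): `u ∈ K̊_p(Q_T) ∩ K̊_∞(Q_T) ∩ C((0,T]; L^p ∩ L^∞)`, with the Kato spaces of §4.1,
`‖u‖_{K^s_p(Q_T)} = sup_{0<t<T} t^{-s/2} ‖u(t)‖_{L^p}` and
`K̊^s_p = {t^{-s/2} ‖u(t)‖_{L^p} → 0 as t ↓ 0}`) asks, beyond the tree's class, for the weighted
`L^p` clause `MemKatoWeightClassOn α p T u` (`α = -s_p/2 = (1 - 3/p)/2 > 0` for `p > 3`). For the
classical Leray–Hopf solutions the continuation criterion is about, every such clause with a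
positive weight exponent holds trivially, because the slices are bounded in `L² ∩ L^∞` on every
closed slab (Tao 2013, `exists_forall_norm_le_of_tao2011`; energy inequality):

* `lintegral_rpow_enorm_le_of_norm_le` — `∫ ‖f‖^r ≤ M^{r-2} ∫ ‖f‖²` for `‖f‖ ≤ M`, `r ≥ 2`;
* `exists_eLpNorm_slice_le_of_classical` — on `[0, T₁]`, `T₁ < T`, `‖u(t)‖_{L^p} ≤ K(T₁) < ∞`
  uniformly (`2 ≤ p < ∞`);
* `katoWeight_of_classical` — for `α > 0` and `2 ≤ p < ∞`:
  `sup_{0<τ<t} τ^α ‖u(τ)‖_{L^p} < ∞` for every `t < T` and `t^α ‖u(t)‖_{L^p} → 0` as `t → 0⁺`,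
  i.e. the two clauses of `MemKatoWeightClassOn α p T u` (stated unbundled, so as not to depend on
  that file while it is under review; the bundled form is `Iff.rfl` away).

## References

* D. Albritton, *Blow-up criteria for the Navier–Stokes equations in non-endpoint critical Besov
  spaces*, Anal. PDE 11 (2018) 1415–1456 = arXiv:1612.04439, §4.1 and Thm. 4.2 (4.52), (4.55).
  [Albritton2018]
* T. Kato, *Strong `L^p`-solutions of the Navier–Stokes equation in `ℝ^m`*, Math. Z. 187 (1984),
  Thm. 1 (the weights `t^{(1-3/q)/2}`).
* T. Tao, Anal. PDE 6 (2013) 25–107, Cor. 11.1, Cor. 4.3, Thm. 5.4. [Tao2011]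
-/

noncomputable section

open MeasureTheory Set Function Filter
open _root_.Topology
open scoped ENNReal NNReal

namespace Literature.Analysis.FluidPDE

/-! ### `L² ∩ L^∞ ⊂ L^r` quantitatively -/

/-- **`∫ ‖f‖^r ≤ M^{r-2} ∫ ‖f‖²` for a field bounded by `M` and `r ≥ 2`** (the elementary
interpolation `L² ∩ L^∞ ⊂ L^r`). [folklore] -/
theorem lintegral_rpow_enorm_le_of_norm_le {α : Type*} [MeasurableSpace α] {μ : Measure α}
    {G : Type*} [NormedAddCommGroup G] {f : α → G} {M : ℝ} (hf : ∀ x, ‖f x‖ ≤ M) {r : ℝ}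
    (hr : 2 ≤ r) :
    ∫⁻ x, ‖f x‖ₑ ^ r ∂μ ≤ ENNReal.ofReal M ^ (r - 2) * ∫⁻ x, ‖f x‖ₑ ^ (2 : ℝ) ∂μ := by
  rw [← lintegral_const_mul' _ _ (ENNReal.rpow_ne_top_of_nonneg (by linarith) ENNReal.ofReal_ne_top)]
  refine lintegral_mono fun x => ?_
  have hsplit : ‖f x‖ₑ ^ r = ‖f x‖ₑ ^ (r - 2) * ‖f x‖ₑ ^ (2 : ℝ) := by
    rw [← ENNReal.rpow_add_of_nonneg (r - 2) 2 (by linarith) (by norm_num)]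
    ring_nf
  rw [hsplit]
  gcongr
  rw [← ofReal_norm]
  exact ENNReal.ofReal_le_ofReal (hf x)

/-- **`‖f‖_{L^p} ≤ (M^{p-2} E)^{1/p}`** for a measurable field bounded by `M` with `∫ ‖f‖² ≤ E`,
`2 ≤ p < ∞`. [folklore] -/
theorem eLpNorm_le_of_norm_le_of_lintegral_sq_le {α : Type*} [MeasurableSpace α] {μ : Measure α}
    {G : Type*} [NormedAddCommGroup G] {f : α → G} {M : ℝ} (hf : ∀ x, ‖f x‖ ≤ M) {E : ℝ≥0∞}
    (hE : ∫⁻ x, ‖f x‖ₑ ^ 2 ∂μ ≤ E) {p : ℝ≥0∞} (hp₂ : 2 ≤ p) (hp : p < ∞) :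
    eLpNorm f p μ ≤ (ENNReal.ofReal M ^ (p.toReal - 2) * E) ^ (1 / p.toReal) := by
  have hp0 : p ≠ 0 := (lt_of_lt_of_le (by norm_num) hp₂).ne'
  have hp2 : 2 ≤ p.toReal := by
    have := ENNReal.toReal_mono hp.ne hp₂
    rwa [ENNReal.toReal_ofNat] at this
  rw [eLpNorm_eq_lintegral_rpow_enorm_toReal hp0 hp.ne]
  gcongr
  refine (lintegral_rpow_enorm_le_of_norm_le hf hp2).trans ?_
  gcongr
  refine le_of_eq_of_le (lintegral_congr fun x => ?_) hE
  rw [ENNReal.rpow_two]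

/-! ### Uniform `L^p` bounds of the slices of a classical Leray–Hopf solution -/

/-- **Slices of a classical Leray–Hopf solution are bounded in `L^p` on closed slabs.** For
`ν > 0`, a classical solution of the unforced system on `ℝ³ × [0, T)`, Leray–Hopf from its rapidly
decaying datum, and `2 ≤ p < ∞`: on every `[0, T₁]`, `T₁ < T`, `‖u(t)‖_{L^p} ≤ K < ∞` uniformly
(pointwise bound `exists_forall_norm_le_of_tao2011`, energy bound `IsLerayHopfOn.lintegral_enorm_sq_le`,
and `eLpNorm_le_of_norm_le_of_lintegral_sq_le`). [cite: Tao2011, Cor. 11.1 + Cor. 4.3 + Thm. 5.4 (iv)] -/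
theorem exists_eLpNorm_slice_le_of_classical {ν T : ℝ} (hν : 0 < ν)
    {u : ℝ → EuclideanSpace ℝ (Fin 3) → EuclideanSpace ℝ (Fin 3)}
    {π : ℝ → EuclideanSpace ℝ (Fin 3) → ℝ}
    (hsol : IsClassicalNSSolutionOn (Ico 0 T) ν 0 u π) (hLH : IsLerayHopfOn T ν 0 (u 0) u)
    (h₀ : HasRapidSpatialDecay (u 0)) {p : ℝ≥0∞} (hp₂ : 2 ≤ p) (hp : p < ∞) :
    ∀ T₁ ∈ Ioo 0 T, ∃ K : ℝ≥0∞, K < ∞ ∧ ∀ t ∈ Icc 0 T₁, eLpNorm (u t) p volume ≤ K := by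
  intro T₁ hT₁
  obtain ⟨M, hM⟩ := exists_forall_norm_le_of_tao2011 tao2011_hasBoundedSobolevNormsOn_holds hν hsol
    hLH h₀ T₁ hT₁
  set E : ℝ≥0∞ := ENNReal.ofReal (2 * VectorCalculus.kineticEnergy (u 0)) with hE
  refine ⟨(ENNReal.ofReal M ^ (p.toReal - 2) * E) ^ (1 / p.toReal), ?_, fun t ht =>
    eLpNorm_le_of_norm_le_of_lintegral_sq_le (hM t ht)
      (hLH.lintegral_enorm_sq_le hν.le ⟨ht.1, ht.2.trans hT₁.2.le⟩) hp₂ hp⟩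
  have hp2 : 2 ≤ p.toReal := by
    have := ENNReal.toReal_mono hp.ne hp₂
    rwa [ENNReal.toReal_ofNat] at this
  refine ENNReal.rpow_lt_top_of_nonneg (by positivity) (ENNReal.mul_ne_top ?_ ENNReal.ofReal_ne_top)
  exact ENNReal.rpow_ne_top_of_nonneg (by linarith) ENNReal.ofReal_ne_top

/-! ### Kato's weighted classes -/

/-- **Classical Leray–Hopf solutions lie in every Kato class `K̊` with positive weight**
(Albritton 2018, §4.1 and Thm. 4.2 (4.52): `u ∈ K̊_p`, weight `t^{(1-3/p)/2}`; Kato 1984,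
Thm. 1). For `ν > 0`, a classical solution on `ℝ³ × [0, T)`, Leray–Hopf from its rapidly decaying
datum, `2 ≤ p < ∞` and `α > 0`: `sup_{0<τ<t} τ^α ‖u(τ)‖_{L^p} < ∞` for every `t < T`, and
`t^α ‖u(t)‖_{L^p} → 0` as `t → 0⁺` — the two clauses of `MemKatoWeightClassOn α p T u`. Proof:
`‖u(τ)‖_{L^p} ≤ K(t)` on `[0, t]` (`exists_eLpNorm_slice_le_of_classical`) and `τ^α ≤ t^α`,
`τ^α → 0`. [cite: Albritton2018, Thm. 4.2 (4.52)] -/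
theorem katoWeight_of_classical {ν T : ℝ} (hν : 0 < ν) (hT : 0 < T)
    {u : ℝ → EuclideanSpace ℝ (Fin 3) → EuclideanSpace ℝ (Fin 3)}
    {π : ℝ → EuclideanSpace ℝ (Fin 3) → ℝ}
    (hsol : IsClassicalNSSolutionOn (Ico 0 T) ν 0 u π) (hLH : IsLerayHopfOn T ν 0 (u 0) u)
    (h₀ : HasRapidSpatialDecay (u 0)) {p : ℝ≥0∞} (hp₂ : 2 ≤ p) (hp : p < ∞) {α : ℝ}
    (hα : 0 < α) :
    (∀ t < T, ⨆ τ ∈ Ioo 0 t, ENNReal.ofReal (τ ^ α) * eLpNorm (u τ) p volume < ∞) ∧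
      Tendsto (fun t => ENNReal.ofReal (t ^ α) * eLpNorm (u t) p volume) (𝓝[>] 0) (𝓝 0) := by
  have hslab := exists_eLpNorm_slice_le_of_classical hν hsol hLH h₀ hp₂ hp
  constructor
  · intro t htT
    rcases le_or_gt t 0 with ht0 | ht0
    · rw [Ioo_eq_empty (not_lt.2 ht0)]
      simp
    · obtain ⟨K, hK, hKb⟩ := hslab t ⟨ht0, htT⟩
      refine lt_of_le_of_lt (iSup₂_le fun τ hτ => ?_)
        (ENNReal.mul_lt_top (ENNReal.ofReal_lt_top (r := t ^ α)) hK)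
      have h1 : ENNReal.ofReal (τ ^ α) ≤ ENNReal.ofReal (t ^ α) :=
        ENNReal.ofReal_le_ofReal (Real.rpow_le_rpow hτ.1.le hτ.2.le hα.le)
      exact mul_le_mul' h1 (hKb τ ⟨hτ.1.le, hτ.2.le⟩)
  · have hT2 : T / 2 ∈ Ioo 0 T := ⟨half_pos hT, half_lt_self hT⟩
    obtain ⟨K, hK, hKb⟩ := hslab (T / 2) hT2
    have hslice : ∀ t ∈ Ioo 0 (T / 2), ENNReal.ofReal (t ^ α) * eLpNorm (u t) p volume ≤
        ENNReal.ofReal (t ^ α) * K := fun t ht =>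
      mul_le_mul' le_rfl (hKb t ⟨ht.1.le, ht.2.le⟩)
    have hpow : Tendsto (fun t : ℝ => ENNReal.ofReal (t ^ α)) (𝓝[>] 0) (𝓝 0) := by
      have hc : Continuous fun t : ℝ => ENNReal.ofReal (t ^ α) :=
        ENNReal.continuous_ofReal.comp (Real.continuous_rpow_const hα.le)
      have := (hc.tendsto 0).mono_left (nhdsWithin_le_nhds (s := Ioi (0 : ℝ)))
      rwa [Real.zero_rpow hα.ne', ENNReal.ofReal_zero] at this
    have hlim : Tendsto (fun t : ℝ => ENNReal.ofReal (t ^ α) * K) (𝓝[>] 0) (𝓝 0) := by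
      simpa only [zero_mul] using ENNReal.Tendsto.mul_const hpow (Or.inr hK.ne)
    refine tendsto_of_tendsto_of_tendsto_of_le_of_le' tendsto_const_nhds hlim
      (Eventually.of_forall fun _ => zero_le) ?_
    filter_upwards [Ioo_mem_nhdsGT (half_pos hT)] with t ht using hslice t ht

end Literature.Analysis.FluidPDE

end
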